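import Summits.Ventures.YMGap.FlowData.RankOneSecondOrder
import HarnessLib

/-!
# Venture YMGap, track Y3 FLOW-DATA — THIRD-ORDER perturbation of a rank-one projection: the top eigenvalue of a
# self-adjoint operator `η`-close to `|e⟩⟨e|` is `t + (2 − t)‖w‖² + ⟪w, T w⟫` up to `20 η⁴`
# (`t = ⟪e, T e⟫`, `w = T e − t e`; theorems only)

HONEST FRAMING: venture file of the cell `pub-ymgap` (QuantumFields programme), track Y3 (FLOW-DATA); an abstract real-Hilbert-space
lemma, the third-order companion of `FlowData/RankOneSecondOrder.lean` (`|‖T‖ − (t + ‖w‖²)| ≤ 4 η³`).  It is the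
operator-theoretic input of the THIRD-ORDER strong-coupling laws of the tube (the `β³` coefficients of `ln λ₀` and of the
magnetic-flux energy `E_mag` on one-site tori — e.g. the `−β³/48` of the `d = 3` one-site cell), for which the second-order
statement is too coarse.  No lattice object appears in this file; nothing about `L → ∞` or the continuum.

Let `T` be bounded self-adjoint on a real Hilbert space with `‖T ψ − ⟪e, ψ⟫ e‖ ≤ η ‖ψ‖` for a unit vector `e` (`0 ≤ η ≤ ¼`), let
`T φ₀ = ‖T‖ φ₀` for a unit `φ₀` (a top eigenvector), and put `λ = ‖T‖`, `t = ⟪e, T e⟫`, `w = T e − t e` (`w ⊥ e`, `‖w‖ ≤ η`,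
`|⟪w, T w⟫| ≤ η ‖w‖²`).

* `norm_le_one_add_of_near_rankOne'` — `‖T‖ ≤ 1 + η` (first order, reproved to keep the import light);
* **`sub_mul_abs_secular_le`** — the SECULAR (Feshbach–Schur) EQUATION WITH REMAINDER:
  `(λ − η) · |λ²(λ − t) − λ‖w‖² − ⟪w, T w⟫| ≤ η³ ‖w‖` — from the two components of `T φ₀ = λ φ₀` along `e` and `e^⊥`
  (`α(λ − t) = ⟪w, φ⟫`, `λ φ = α w + (T φ − ⟪w, φ⟫ e)` for `φ₀ = α e + φ`), eliminating `φ` to the displayed order;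
* **`abs_norm_sub_third_order_le`** — `|‖T‖ − (t + (2 − t)‖w‖² + ⟪w, T w⟫)| ≤ 20 η⁴`, i.e. with `T = |e⟩⟨e| + A`,
  `Q = 1 − |e⟩⟨e|`: `λ_max = 1 + A_{ee} + (1 − A_{ee})‖Q A e‖² + ⟪Q A e, A Q A e⟫ + O(‖A‖⁴)` — Rayleigh–Schrödinger to third
  order about a non-degenerate rank-one level, with an explicit constant (`real_thirdOrder_core` is the real-arithmetic step).

References: T. Kato, *Perturbation Theory for Linear Operators* (1966), §II.2 (reduction to the `e`-component: the
eigenvalue equation `λ − t = ⟪w, (λ − QTQ)⁻¹ w⟫` expanded to second order in `QTQ`) [cite: Kato1966, §II.2]; M. Reed, B. Simon IV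
(1978) §XII.1 [cite: ReedSimonIV1978, §XII.1].
-/

noncomputable section

open scoped RealInnerProductSpace

namespace Summit.Ventures.YMGap.FlowData

section ThirdOrder

variable {H : Type*} [NormedAddCommGroup H] [InnerProductSpace ℝ H]

/-- `‖T‖ ≤ 1 + η` when `‖T ψ − ⟪e, ψ⟫ e‖ ≤ η ‖ψ‖` for a unit `e`. [folklore] -/
theorem norm_le_one_add_of_near_rankOne' (T : H →L[ℝ] H) {e : H} (he : ‖e‖ = 1) {η : ℝ} (hη0 : 0 ≤ η)
    (hT : ∀ ψ, ‖T ψ - ⟪e, ψ⟫ • e‖ ≤ η * ‖ψ‖) : ‖T‖ ≤ 1 + η := by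
  refine ContinuousLinearMap.opNorm_le_bound T (by linarith) fun ψ => ?_
  have h1 : ‖⟪e, ψ⟫ • e‖ ≤ ‖ψ‖ := by
    rw [norm_smul, he, mul_one]
    have := abs_real_inner_le_norm e ψ
    rwa [he, one_mul] at this
  calc ‖T ψ‖ = ‖(T ψ - ⟪e, ψ⟫ • e) + ⟪e, ψ⟫ • e‖ := by rw [sub_add_cancel]
    _ ≤ ‖T ψ - ⟪e, ψ⟫ • e‖ + ‖⟪e, ψ⟫ • e‖ := norm_add_le _ _
    _ ≤ η * ‖ψ‖ + ‖ψ‖ := add_le_add (hT ψ) h1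
    _ = (1 + η) * ‖ψ‖ := by ring

/-- Removing the `e`-component does not increase the norm: `‖x − ⟪e, x⟫ e‖ ≤ ‖x‖` for a unit `e`. [folklore] -/
theorem norm_sub_inner_smul_self_le {e : H} (he : ‖e‖ = 1) (x : H) : ‖x - ⟪e, x⟫ • e‖ ≤ ‖x‖ := by
  have hsq : ‖x - ⟪e, x⟫ • e‖ ^ 2 = ‖x‖ ^ 2 - ⟪e, x⟫ ^ 2 := by
    rw [@norm_sub_sq_real, norm_smul, he, mul_one, Real.norm_eq_abs, sq_abs, inner_smul_right, real_inner_comm]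
    ring
  have h1 : ‖x - ⟪e, x⟫ • e‖ ^ 2 ≤ ‖x‖ ^ 2 := by rw [hsq]; linarith [sq_nonneg ⟪e, x⟫]
  exact (pow_le_pow_iff_left₀ (norm_nonneg _) (norm_nonneg _) two_ne_zero).1 h1

/-- On `e^⊥` the operator is small in norm: `‖T φ‖ ≤ η ‖φ‖` for `φ ⊥ e`. [folklore] -/
theorem norm_apply_le_of_orthogonal (T : H →L[ℝ] H) {e : H} {η : ℝ}
    (hT : ∀ ψ, ‖T ψ - ⟪e, ψ⟫ • e‖ ≤ η * ‖ψ‖) {φ : H} (hφ : ⟪e, φ⟫ = 0) : ‖T φ‖ ≤ η * ‖φ‖ := by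
  have h := hT φ
  rwa [hφ, zero_smul, sub_zero] at h

/-- **THE SECULAR EQUATION WITH REMAINDER.**  For self-adjoint `T` with `‖T ψ − ⟪e, ψ⟫ e‖ ≤ η ‖ψ‖` (`‖e‖ = 1`, `0 ≤ η`), a unit
top eigenvector `T φ₀ = ‖T‖ φ₀`, `λ = ‖T‖`, `t = ⟪e, T e⟫`, `w = T e − t e`:
`(λ − η) · |λ²(λ − t) − λ ‖w‖² − ⟪w, T w⟫| ≤ η³ ‖w‖`.
(Write `φ₀ = α e + φ`, `φ ⊥ e`.  The `e`-component of the eigen-equation is `α(λ − t) = ⟪w, φ⟫`, the `e^⊥`-component is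
`λ φ = α w + r` with `r = T φ − ⟪w, φ⟫ e`, `‖r‖ ≤ η‖φ‖`; pairing the latter with `w` and then with `q = T w − ‖w‖² e`
(`‖q‖ ≤ η‖w‖`) gives `α · (λ²(λ − t) − λ‖w‖² − ⟪w, Tw⟫) = ⟪q, r⟫`, while `(λ − η)‖φ‖ ≤ |α| η`.) [cite: Kato1966, §II.2] -/
theorem sub_mul_abs_secular_le (T : H →L[ℝ] H) (hsa : ∀ x y : H, ⟪T x, y⟫ = ⟪x, T y⟫)
    {e : H} (he : ‖e‖ = 1) {φ₀ : H} (h0 : ‖φ₀‖ = 1) (heig : T φ₀ = ‖T‖ • φ₀) {η : ℝ} (hη0 : 0 ≤ η)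
    (hT : ∀ ψ, ‖T ψ - ⟪e, ψ⟫ • e‖ ≤ η * ‖ψ‖) :
    (‖T‖ - η) * |‖T‖ ^ 2 * (‖T‖ - ⟪e, T e⟫) - ‖T‖ * ‖T e - ⟪e, T e⟫ • e‖ ^ 2 -
        ⟪T e - ⟪e, T e⟫ • e, T (T e - ⟪e, T e⟫ • e)⟫| ≤ η ^ 3 * ‖T e - ⟪e, T e⟫ • e‖ := by
  have hwη0 := norm_sub_inner_smul_le T he hT
  have hee : ⟪e, e⟫ = 1 := by rw [real_inner_self_eq_norm_sq, he, one_pow]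
  -- name the scalars and vectors (opaque variables with defining equations)
  obtain ⟨lam, hlam⟩ : ∃ lam : ℝ, ‖T‖ = lam := ⟨_, rfl⟩
  obtain ⟨t, ht⟩ : ∃ t : ℝ, ⟪e, T e⟫ = t := ⟨_, rfl⟩
  have hlam0 : 0 ≤ lam := by rw [← hlam]; exact norm_nonneg _
  rw [hlam] at heig
  rw [hlam, ht]
  rw [ht] at hwη0
  obtain ⟨w, hw⟩ : ∃ w : H, T e - t • e = w := ⟨_, rfl⟩
  rw [hw] at hwη0 ⊢
  have hTe : T e = w + t • e := by rw [← hw]; abel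
  have hew : ⟪e, w⟫ = 0 := by rw [← hw, inner_sub_right, inner_smul_right, hee, mul_one, ht, sub_self]
  -- decomposition of the eigenvector
  obtain ⟨α, hα⟩ : ∃ α : ℝ, ⟪e, φ₀⟫ = α := ⟨_, rfl⟩
  obtain ⟨φ, hφ⟩ : ∃ φ : H, φ₀ - α • e = φ := ⟨_, rfl⟩
  have heφ : ⟪e, φ⟫ = 0 := by rw [← hφ, inner_sub_right, inner_smul_right, hee, mul_one, hα, sub_self]
  have hdec : φ₀ = α • e + φ := by rw [← hφ]; abel
  have hnorm : α ^ 2 + ‖φ‖ ^ 2 = 1 := by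
    have h1 : ‖φ₀‖ ^ 2 = ‖α • e + φ‖ ^ 2 := by rw [← hdec]
    rw [h0, one_pow, @norm_add_sq_real, norm_smul, he, mul_one, Real.norm_eq_abs, sq_abs, real_inner_smul_left, heφ,
      mul_zero, mul_zero, add_zero] at h1
    linarith
  -- smallness on `e^⊥`
  have hTφ : ‖T φ‖ ≤ η * ‖φ‖ := norm_apply_le_of_orthogonal T hT heφ
  have hTw : ‖T w‖ ≤ η * ‖w‖ := norm_apply_le_of_orthogonal T hT hew
  -- `⟪e, T φ⟫ = ⟪w, φ⟫`, `⟪e, T w⟫ = ‖w‖²`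
  have heTφ : ⟪e, T φ⟫ = ⟪w, φ⟫ := by
    rw [← hsa, hTe, inner_add_left, real_inner_smul_left, heφ, mul_zero, add_zero]
  have heTw : ⟪e, T w⟫ = ‖w‖ ^ 2 := by
    rw [← hsa, hTe, inner_add_left, real_inner_smul_left, hew, mul_zero, add_zero, real_inner_self_eq_norm_sq]
  -- the `e`-component of the eigen-equation: `α (λ − t) = ⟪w, φ⟫`
  have hE1 : α * (lam - t) = ⟪w, φ⟫ := by
    have h1 : ⟪e, T φ₀⟫ = lam * α := by rw [heig, inner_smul_right, hα]
    have h2 : ⟪e, T φ₀⟫ = α * t + ⟪w, φ⟫ := by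
      rw [hdec, map_add, map_smul, inner_add_right, inner_smul_right, ht, heTφ]
    linarith [h1.symm.trans h2]
  -- the `e^⊥`-component: `λ φ − α w = T φ − ⟪w, φ⟫ e =: r`, `‖r‖ ≤ η ‖φ‖`
  obtain ⟨r, hr⟩ : ∃ r : H, T φ - ⟪w, φ⟫ • e = r := ⟨_, rfl⟩
  have hE2 : lam • φ - α • w = r := by
    have h1 : lam • (α • e) + lam • φ = α • w + α • (t • e) + T φ := by
      have h := heig.symm
      rw [hdec, map_add, map_smul, hTe] at h
      simpa only [smul_add] using h
    have h3 : lam • φ = α • w + α • (t • e) + T φ - lam • (α • e) := by rw [← h1]; abel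
    have h4 : ⟪w, φ⟫ • e = (lam * α) • e - (α * t) • e := by rw [← hE1, mul_sub, sub_smul, mul_comm α lam]
    rw [← hr, h3, h4, smul_smul, smul_smul]
    abel
  have hrn : ‖r‖ ≤ η * ‖φ‖ := by
    have h1 : ‖r‖ ≤ ‖T φ‖ := by
      rw [← hr, ← heTφ]
      exact norm_sub_inner_smul_self_le he (T φ)
    exact h1.trans hTφ
  -- `(λ − η) ‖φ‖ ≤ |α| η`
  have hs : (lam - η) * ‖φ‖ ≤ |α| * η := by
    have h1 : ‖lam • φ‖ ≤ ‖α • w‖ + ‖r‖ := by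
      have : lam • φ = α • w + r := by rw [← hE2]; abel
      rw [this]; exact norm_add_le _ _
    rw [norm_smul, norm_smul, Real.norm_eq_abs, Real.norm_eq_abs, abs_of_nonneg hlam0] at h1
    have h2 : |α| * ‖w‖ ≤ |α| * η := mul_le_mul_of_nonneg_left hwη0 (abs_nonneg _)
    have h3 : (lam - η) * ‖φ‖ = lam * ‖φ‖ - η * ‖φ‖ := by ring
    rw [h3]
    linarith
  -- `q = T w − ‖w‖² e`, `‖q‖ ≤ η ‖w‖`, `⟪q, w⟫ = ⟪w, T w⟫`, `⟪q, φ⟫ = ⟪T w, φ⟫`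
  obtain ⟨q, hq⟩ : ∃ q : H, T w - (‖w‖ ^ 2) • e = q := ⟨_, rfl⟩
  have hqn : ‖q‖ ≤ η * ‖w‖ := by
    have h1 : ‖q‖ ≤ ‖T w‖ := by
      rw [← hq, ← heTw]
      exact norm_sub_inner_smul_self_le he (T w)
    exact h1.trans hTw
  have hqw : ⟪q, w⟫ = ⟪w, T w⟫ := by
    rw [← hq, inner_sub_left, real_inner_smul_left, hew, mul_zero, sub_zero, real_inner_comm]
  have hqφ : ⟪q, φ⟫ = ⟪T w, φ⟫ := by
    rw [← hq, inner_sub_left, real_inner_smul_left, heφ, mul_zero, sub_zero]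
  -- pair the `e^⊥`-equation with `w`: `λ ⟪w, φ⟫ − α ‖w‖² = ⟪T w, φ⟫`
  have hI1 : lam * ⟪w, φ⟫ - α * ‖w‖ ^ 2 = ⟪T w, φ⟫ := by
    have h1 : ⟪w, lam • φ - α • w⟫ = ⟪w, r⟫ := by rw [hE2]
    rw [inner_sub_right, inner_smul_right, inner_smul_right, real_inner_self_eq_norm_sq] at h1
    rw [h1, ← hr, inner_sub_right, inner_smul_right, real_inner_comm e w, hew, mul_zero, sub_zero, ← hsa]
  -- pair it with `q`: `λ ⟪T w, φ⟫ = α ⟪w, T w⟫ + ⟪q, r⟫`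
  have hI2 : lam * ⟪T w, φ⟫ = α * ⟪w, T w⟫ + ⟪q, r⟫ := by
    have h1 : ⟪q, lam • φ - α • w⟫ = ⟪q, r⟫ := by rw [hE2]
    rw [inner_sub_right, inner_smul_right, inner_smul_right, hqφ, hqw] at h1
    linarith
  -- eliminate `⟪w, φ⟫` and `⟪T w, φ⟫`
  have hX : α * (lam ^ 2 * (lam - t) - lam * ‖w‖ ^ 2 - ⟪w, T w⟫) = ⟪q, r⟫ := by
    have h1 : lam ^ 2 * ⟪w, φ⟫ - lam * α * ‖w‖ ^ 2 = lam * ⟪T w, φ⟫ := by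
      rw [← hI1]; ring
    rw [hI2, ← hE1] at h1
    linear_combination h1
  have hαX : |α| * |lam ^ 2 * (lam - t) - lam * ‖w‖ ^ 2 - ⟪w, T w⟫| ≤ η ^ 2 * ‖w‖ * ‖φ‖ := by
    rw [← abs_mul, hX]
    calc |⟪q, r⟫| ≤ ‖q‖ * ‖r‖ := abs_real_inner_le_norm _ _
      _ ≤ η * ‖w‖ * (η * ‖φ‖) := mul_le_mul hqn hrn (norm_nonneg _) (by positivity)
      _ = η ^ 2 * ‖w‖ * ‖φ‖ := by ring
  -- conclude
  by_cases hlη : lam - η ≤ 0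
  · calc (lam - η) * |lam ^ 2 * (lam - t) - lam * ‖w‖ ^ 2 - ⟪w, T w⟫| ≤ 0 :=
        mul_nonpos_of_nonpos_of_nonneg hlη (abs_nonneg _)
      _ ≤ η ^ 3 * ‖w‖ := by positivity
  push Not at hlη
  have hα0 : α ≠ 0 := by
    intro hα0
    rw [hα0, abs_zero, zero_mul] at hs
    have hφ0 : ‖φ‖ = 0 := by
      refine le_antisymm ?_ (norm_nonneg _)
      by_contra hpos
      push Not at hpos
      linarith [mul_pos hlη hpos]
    rw [hα0, hφ0] at hnorm
    norm_num at hnorm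
  have hαpos : 0 < |α| := abs_pos.2 hα0
  have h1 : (lam - η) * |lam ^ 2 * (lam - t) - lam * ‖w‖ ^ 2 - ⟪w, T w⟫| * |α| ≤
      η ^ 2 * ‖w‖ * ((lam - η) * ‖φ‖) := by
    have := mul_le_mul_of_nonneg_left hαX hlη.le
    linarith [this]
  have h2 : η ^ 2 * ‖w‖ * ((lam - η) * ‖φ‖) ≤ η ^ 2 * ‖w‖ * (|α| * η) :=
    mul_le_mul_of_nonneg_left hs (by positivity)
  have h3 : (lam - η) * |lam ^ 2 * (lam - t) - lam * ‖w‖ ^ 2 - ⟪w, T w⟫| * |α| ≤ (η ^ 3 * ‖w‖) * |α| := by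
    calc (lam - η) * |lam ^ 2 * (lam - t) - lam * ‖w‖ ^ 2 - ⟪w, T w⟫| * |α|
        ≤ η ^ 2 * ‖w‖ * (|α| * η) := h1.trans h2
      _ = (η ^ 3 * ‖w‖) * |α| := by ring
  exact le_of_mul_le_mul_right h3 hαpos

/-- The real-arithmetic core of the third-order bound: from the secular relation `(λ − η)|X| ≤ η⁴`,
`X = λ²(λ − t) − λ n − κ`, and the a-priori windows (`|t − 1| ≤ η`, `0 ≤ n ≤ η²`, `|κ| ≤ η n`,
`t + n − 2η³ ≤ λ ≤ min(1 + η, t + n + 4η³)`, `η ≤ ¼`) conclude `|λ − (t + (2 − t) n + κ)| ≤ 20 η⁴`. [folklore] -/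
theorem real_thirdOrder_core {lam t n κ X η : ℝ} (hη0 : 0 ≤ η) (hη : η ≤ 1 / 4) (ht : |t - 1| ≤ η)
    (hn0 : 0 ≤ n) (hn : n ≤ η ^ 2) (hκ : |κ| ≤ η * n) (hlo : t + n - 2 * η ^ 3 ≤ lam) (hhi : lam ≤ 1 + η)
    (hhi' : lam ≤ t + n + 4 * η ^ 3) (hX : X = lam ^ 2 * (lam - t) - lam * n - κ)
    (hXb : (lam - η) * |X| ≤ η ^ 4) :
    |lam - (t + (2 - t) * n + κ)| ≤ 20 * η ^ 4 := by
  obtain ⟨ht1, ht2⟩ := abs_le.1 ht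
  obtain ⟨hκ1, hκ2⟩ := abs_le.1 hκ
  have hη2 : η ^ 2 ≤ 1 / 16 := by nlinarith
  have hη3 : η ^ 3 ≤ η / 16 := by nlinarith [mul_le_mul_of_nonneg_left hη2 hη0]
  have hη3' : η ^ 3 ≤ η ^ 2 / 4 := by nlinarith [mul_le_mul_of_nonneg_left hη (sq_nonneg η)]
  have hκ' : |κ| ≤ η ^ 3 := hκ.trans (by nlinarith [mul_le_mul_of_nonneg_left hn hη0])
  -- windows for `λ`
  have hlam : 23 / 32 ≤ lam := by linarith
  have hlamη : 15 / 32 ≤ lam - η := by linarith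
  have hl54 : lam ≤ 5 / 4 := by linarith
  -- `|X| ≤ (32/15) η⁴`
  have hXabs : |X| ≤ 32 / 15 * η ^ 4 := by
    have h1 : 15 / 32 * |X| ≤ η ^ 4 := (mul_le_mul_of_nonneg_right hlamη (abs_nonneg _)).trans hXb
    linarith
  -- `|λ − t| ≤ 2 η²`, `|λ − 1| ≤ (9/8) η`
  have hlt : |lam - t| ≤ 2 * η ^ 2 := abs_le.2 ⟨by linarith, by linarith⟩
  have hl1 : |lam - 1| ≤ 9 / 8 * η := abs_le.2 ⟨by linarith, by linarith⟩
  -- `|λ(2 − t) − 1| ≤ (25/8) η²`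
  have hA : |lam * (2 - t) - 1| ≤ 25 / 8 * η ^ 2 := by
    have e : lam * (2 - t) - 1 = (lam - t) - (lam - 1) * (t - 1) := by ring
    rw [e]
    calc |(lam - t) - (lam - 1) * (t - 1)| ≤ |lam - t| + |(lam - 1) * (t - 1)| := abs_sub _ _
      _ ≤ 2 * η ^ 2 + 9 / 8 * η * η := by
          rw [abs_mul]
          exact add_le_add hlt (mul_le_mul hl1 ht (abs_nonneg _) (by positivity))
      _ = 25 / 8 * η ^ 2 := by ring
  -- `|κ (λ² − 1)| ≤ (81/32) η⁴`
  have hB : |κ * (lam ^ 2 - 1)| ≤ 81 / 32 * η ^ 4 := by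
    have hl2 : |lam ^ 2 - 1| ≤ 9 / 8 * η * (9 / 4) := by
      have e : lam ^ 2 - 1 = (lam - 1) * (lam + 1) := by ring
      rw [e, abs_mul]
      refine mul_le_mul hl1 ?_ (abs_nonneg _) (by positivity)
      rw [abs_of_nonneg (by linarith)]
      linarith
    rw [abs_mul]
    calc |κ| * |lam ^ 2 - 1| ≤ η ^ 3 * (9 / 8 * η * (9 / 4)) := mul_le_mul hκ' hl2 (abs_nonneg _) (by positivity)
      _ = 81 / 32 * η ^ 4 := by ring
  -- `|n λ (λ(2−t) − 1)| ≤ (125/32) η⁴`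
  have hC : |n * lam * (lam * (2 - t) - 1)| ≤ 125 / 32 * η ^ 4 := by
    rw [abs_mul, abs_mul, abs_of_nonneg hn0, abs_of_nonneg (by linarith : (0:ℝ) ≤ lam)]
    calc n * lam * |lam * (2 - t) - 1| ≤ η ^ 2 * (5 / 4) * (25 / 8 * η ^ 2) :=
          mul_le_mul (mul_le_mul hn hl54 (by linarith) (by positivity)) hA (abs_nonneg _) (by positivity)
      _ = 125 / 32 * η ^ 4 := by ring
  -- the identity `λ² D = X − n λ (λ(2−t) − 1) − κ(λ² − 1)` for `D = λ − (t + (2 − t) n + κ)`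
  have hid : lam ^ 2 * (lam - (t + (2 - t) * n + κ)) = X - n * lam * (lam * (2 - t) - 1) - κ * (lam ^ 2 - 1) := by
    rw [hX]; ring
  have hD2 : lam ^ 2 * |lam - (t + (2 - t) * n + κ)| ≤ 32 / 15 * η ^ 4 + 125 / 32 * η ^ 4 + 81 / 32 * η ^ 4 := by
    have h1 : lam ^ 2 * |lam - (t + (2 - t) * n + κ)| = |lam ^ 2 * (lam - (t + (2 - t) * n + κ))| := by
      rw [abs_mul, abs_of_nonneg (sq_nonneg lam)]
    rw [h1, hid]
    calc |X - n * lam * (lam * (2 - t) - 1) - κ * (lam ^ 2 - 1)|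
        ≤ |X - n * lam * (lam * (2 - t) - 1)| + |κ * (lam ^ 2 - 1)| := abs_sub _ _
      _ ≤ |X| + |n * lam * (lam * (2 - t) - 1)| + |κ * (lam ^ 2 - 1)| := add_le_add (abs_sub _ _) le_rfl
      _ ≤ 32 / 15 * η ^ 4 + 125 / 32 * η ^ 4 + 81 / 32 * η ^ 4 := by linarith
  -- divide by `λ² ≥ (23/32)²`
  have hl2 : (23 / 32 : ℝ) ^ 2 ≤ lam ^ 2 := pow_le_pow_left₀ (by norm_num) hlam 2
  have hD0 : 0 ≤ |lam - (t + (2 - t) * n + κ)| := abs_nonneg _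
  have h5 := mul_le_mul_of_nonneg_right hl2 hD0
  have h4 : 0 ≤ η ^ 4 := by positivity
  nlinarith [h5, hD2, h4]

/-- **THIRD-ORDER PERTURBATION OF A RANK-ONE PROJECTION.**  Let `T` be bounded self-adjoint on a real Hilbert space with
`‖T ψ − ⟪e, ψ⟫ e‖ ≤ η ‖ψ‖` (`‖e‖ = 1`, `0 ≤ η ≤ ¼`) and let `T φ₀ = ‖T‖ φ₀` for a unit vector `φ₀`.  With `t = ⟪e, T e⟫` and
`w = T e − t e`:  `|‖T‖ − (t + (2 − t) ‖w‖² + ⟪w, T w⟫)| ≤ 20 η⁴`.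
With `T = |e⟩⟨e| + A`, `Q = 1 − |e⟩⟨e|` this reads `λ_max(T) = 1 + A_{ee} + (1 − A_{ee}) ‖Q A e‖² + ⟪Q A e, A Q A e⟫ + O(‖A‖⁴)`:
the Rayleigh–Schrödinger series to THIRD order with an explicit remainder. [cite: Kato1966, §II.2] -/
theorem abs_norm_sub_third_order_le (T : H →L[ℝ] H) (hsa : ∀ x y : H, ⟪T x, y⟫ = ⟪x, T y⟫)
    {e : H} (he : ‖e‖ = 1) {φ₀ : H} (h0 : ‖φ₀‖ = 1) (heig : T φ₀ = ‖T‖ • φ₀) {η : ℝ} (hη0 : 0 ≤ η) (hη : η ≤ 1 / 4)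
    (hT : ∀ ψ, ‖T ψ - ⟪e, ψ⟫ • e‖ ≤ η * ‖ψ‖) :
    |‖T‖ - (⟪e, T e⟫ + (2 - ⟪e, T e⟫) * ‖T e - ⟪e, T e⟫ • e‖ ^ 2 +
        ⟪T e - ⟪e, T e⟫ • e, T (T e - ⟪e, T e⟫ • e)⟫)| ≤ 20 * η ^ 4 := by
  have hwη := norm_sub_inner_smul_le T he hT
  have hew : ⟪e, T e - ⟪e, T e⟫ • e⟫ = 0 := by
    rw [inner_sub_right, inner_smul_right, real_inner_self_eq_norm_sq, he, one_pow, mul_one, sub_self]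
  have ht1 := abs_inner_sub_one_le T he hT
  have hκ := abs_inner_apply_le_of_orthogonal T hT hew
  have hlo := inner_add_norm_sq_sub_le_norm T hsa he hη0 hT
  have hhi' := norm_le_inner_add_norm_sq_add T hsa he h0 heig hη0 hη hT
  have hhi := norm_le_one_add_of_near_rankOne' T he hη0 hT
  have hsec := sub_mul_abs_secular_le T hsa he h0 heig hη0 hT
  have hn : ‖T e - ⟪e, T e⟫ • e‖ ^ 2 ≤ η ^ 2 := pow_le_pow_left₀ (norm_nonneg _) hwη 2
  have hXb : (‖T‖ - η) * |‖T‖ ^ 2 * (‖T‖ - ⟪e, T e⟫) - ‖T‖ * ‖T e - ⟪e, T e⟫ • e‖ ^ 2 -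
      ⟪T e - ⟪e, T e⟫ • e, T (T e - ⟪e, T e⟫ • e)⟫| ≤ η ^ 4 := by
    refine hsec.trans ?_
    calc η ^ 3 * ‖T e - ⟪e, T e⟫ • e‖ ≤ η ^ 3 * η := mul_le_mul_of_nonneg_left hwη (by positivity)
      _ = η ^ 4 := by ring
  exact real_thirdOrder_core hη0 hη ht1 (sq_nonneg _) hn hκ hlo hhi hhi' rfl hXb

end ThirdOrder

end Summit.Ventures.YMGap.FlowData
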